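import Literature.NumberTheory.Automorphic.SelfDualLatticeCountFrameTransport     -- ★ (L5-d1) FILE A: `image_map_inv_selfDualStable_eq` pattern, brings ★ `FixedCosetsStableLattices`
import Literature.NumberTheory.Automorphic.PlaneLatticesCompanionScalarReduction    -- ★ B-p08 (g27): `map_le_map_smul_one_iff`
import Literature.NumberTheory.Automorphic.IwahoriGL                                -- ★ `glIntReduction`, `iwahoriGL`
import HarnessLib

/-!
# The SCALAR-REDUCTION refinement of the self-dual stable lattice count: frame transport, fixed-coset dictionary, and the `2 × 2` monodromy dictionary
(Kottwitz 1988 §2: interior versus boundary vertices of the fixed ball of an elliptic element on the tree of `U(1,1)`)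

Topic `NumberTheory/Automorphic`; namespace `Literature.NumberTheory.Automorphic`.  THEOREMS ONLY (no definition, no instance, no notation, no named fact, no
`sorry`).  Cell `pub/hodgecm-mathlib` (D-0151), crux H413 = `stmt-HodgeConjecture-24833`, line «N6nsGerm», stub `stub_N6nsR2EP : RankOneEulerPoincareNonsplit`
((R2), Kottwitz's Euler–Poincaré function on `U(Φ₂)_v`), brick (R2-t2) «TYPE-(2) EDGE COUNT» FILE A (B-p08 (g28) census `CENSUS-R2t2-E2-assembly.B-p08g28.md`;
EP pen B-p04 (g34) E-PLAN (R3)(R4)(R5); LEAD F0P3a-plan (g10) WORD T9-8 (C)).  GENERIC layer over a field `F` with a valuative relation and `σ : F →+* F`.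
HONEST LABEL: HC_CM is proved only modulo the cell's remaining named inputs (hLiu418, h413) until rung 0 closes; nothing printed is asserted here.

THE MATHEMATICS.  `S(J, γ) = {Λ = Λ(g) | ᵗσ(g) J g ∈ GL_n(𝒪), γΛ = Λ}` is the ★ inline set of `γ`-stable self-dual lattices (`Λ(g) = span_𝒪` of the columns of `g`).
For a matrix `A` and a scalar `b ≠ 0` the REFINED set `S_{A,b}(J, γ) = {Λ ∈ S(J, γ) | A·Λ ≤ b·Λ}` (for `A = γ − a·1`, `b = ϖ`: «`γ ≡ a·1 (mod ϖ)` on `Λ`», i.e. the local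
monodromy of `γ` at the vertex `Λ` reduces to the SCALAR `a`) is
* §1 transported along any change of frame `P`: `Λ ↦ P⁻¹Λ` maps `S_{A,b}(J, γ)` onto `S_{P⁻¹AP, b}(ᵗσ(P)JP, P⁻¹γP)` (`image_map_inv_selfDualStable_mapLE_eq`), whence
  **`ncard_selfDualStable_mapLE_congr`** and its scalar-shift form **`ncard_selfDualStable_subSmul_congr`** (`P⁻¹(γ − a·1)P = P⁻¹γP − a·1`) — the refined (L5-d1);
* §2 read on the group side: for `U = U(σ, J)`, `K_U = U ∩ GL_n(𝒪)`, **`natCard_fixedBy_unitary_subtype_eq_ncard`**: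
  `#{x ∈ Fix_γ(U ⧸ K_U) | b⁻¹·(out x)⁻¹ A (out x) integral} = #{Λ(u), u ∈ U | γΛ = Λ ∧ A·Λ ≤ b·Λ}` (★ `map_le_map_smul_one_iff`, refining ★ `natCard_fixedBy_unitary_eq_ncard`);
* §3 the `2 × 2` MONODROMY DICTIONARY: `(k − (tr k∕2)·1)² = ((tr² − 4 det)∕4)·1` (`sub_smul_one_mul_self_eq_smul_one`), conjugation keeps `tr, det`, and the conjugate of
  `γ − a·1` is `k − a·1` (`units_inv_mul_sub_smul_one_mul`);
* §4 REDUCTION mod `𝓂` of an integral matrix `k ∈ GL_n(𝒪)`: `k̄ = ā·1 ↔ ϖ⁻¹(k − a·1)` integral (`glIntReduction_eq_smul_one_iff`), and `(k − a·1)² = e·1` with `|e| < 1`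
  forces `(k̄ − ā·1)² = 0` (`glIntReduction_sub_smul_one_sq_eq_zero`); a unit congruence `|x y − 1| < 1` reduces to `x̄ ȳ = 1` (`residue_mul_residue_eq_one`).
For a type-(2) elliptic `γ` (`ϖ ∣ tr² − 4det`) every local monodromy is thus a SCALAR or a TRANSVECTION modulo `𝓂`, never split — the two star types of Kottwitz's edge count.

## References
* [Kottwitz1988] R. E. Kottwitz, *Tamagawa numbers*, Ann. of Math. 127 (1988), §2 (Euler–Poincaré functions; fixed edges over fixed vertices).
* [Kottwitz1986] R. E. Kottwitz, *Base change for unit elements of Hecke algebras*, Compositio Math. 60 (1986), §3 (lattice counts, change of frame).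
* [Macdonald1995] I. G. Macdonald, *Symmetric Functions and Hall Polynomials*, 2nd ed. (1995), Ch. V §2 (lattices `Λ(g)`, `Λ(B) ≤ Λ(g)` iff `g⁻¹B` integral).
* [IwahoriMatsumoto1965] N. Iwahori, H. Matsumoto, Publ. Math. IHÉS 25 (1965), §2 (reduction mod `𝔓` on `GL_n(𝒪)`).
* [HornJohnson2013] R. A. Horn, C. R. Johnson, *Matrix Analysis*, 2nd ed. (2013), Thm. 2.4.3.2 (Cayley–Hamilton), §1.3 (similarity invariants).
-/

set_option autoImplicit false

noncomputable section

open scoped ValuativeRel Matrix MatrixGroups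
open Set Matrix ValuativeRel

namespace Literature.NumberTheory.Automorphic

variable {F : Type*} [Field F] [ValuativeRel F] {n : ℕ} (σ : F →+* F)

/-! ## §1 Refined frame transport: `#S_{A,b}(J, γ) = #S_{P⁻¹AP, b}(ᵗσ(P) J P, P⁻¹ γ P)` -/

section Transport

omit [ValuativeRel F] in
/-- `P⁻¹ (A − a·1) P = P⁻¹ A P − a·1`. [cite: HornJohnson2013, §1.3] -/
theorem units_inv_mul_sub_smul_one_mul (P : GL (Fin n) F) (A : Matrix (Fin n) (Fin n) F) (a : F) :
    ((P⁻¹ : GL (Fin n) F) : Matrix (Fin n) (Fin n) F) * (A - a • (1 : Matrix (Fin n) (Fin n) F)) * (P : Matrix (Fin n) (Fin n) F) =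
      ((P⁻¹ : GL (Fin n) F) : Matrix (Fin n) (Fin n) F) * A * (P : Matrix (Fin n) (Fin n) F) - a • (1 : Matrix (Fin n) (Fin n) F) := by
  rw [Matrix.mul_sub, Matrix.sub_mul, Matrix.mul_smul, Matrix.mul_one, Matrix.smul_mul, Units.inv_mul]

omit [ValuativeRel F] in
/-- `P⁻¹ (b·1) P = b·1`. [cite: HornJohnson2013, §1.3] -/
theorem units_inv_mul_smul_one_mul (P : GL (Fin n) F) (b : F) :
    ((P⁻¹ : GL (Fin n) F) : Matrix (Fin n) (Fin n) F) * (b • (1 : Matrix (Fin n) (Fin n) F)) * (P : Matrix (Fin n) (Fin n) F) = b • (1 : Matrix (Fin n) (Fin n) F) := by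
  rw [Matrix.mul_smul, Matrix.mul_one, Matrix.smul_mul, Units.inv_mul]

/-- `(P⁻¹Λ)` mapped by `P⁻¹ A P` is `P⁻¹ (A Λ)`. [cite: Kottwitz1986, §3] -/
theorem map_map_inv_conj_eq (P : GL (Fin n) F) (A : Matrix (Fin n) (Fin n) F) (Λ : Submodule 𝒪[F] (Fin n → F)) :
    (Λ.map ((Matrix.toLin' ((P⁻¹ : GL (Fin n) F) : Matrix (Fin n) (Fin n) F)).restrictScalars 𝒪[F])).map
        ((Matrix.toLin' (((P⁻¹ : GL (Fin n) F) : Matrix (Fin n) (Fin n) F) * A * (P : Matrix (Fin n) (Fin n) F))).restrictScalars 𝒪[F]) =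
      (Λ.map ((Matrix.toLin' A).restrictScalars 𝒪[F])).map ((Matrix.toLin' ((P⁻¹ : GL (Fin n) F) : Matrix (Fin n) (Fin n) F)).restrictScalars 𝒪[F]) := by
  rw [← Submodule.map_comp, ← Submodule.map_comp]
  congr 1
  apply LinearMap.ext
  intro x
  simp only [LinearMap.comp_apply, LinearMap.restrictScalars_apply, Matrix.toLin'_apply, Matrix.mulVec_mulVec, Matrix.mul_assoc, Units.mul_inv,
    Matrix.mul_one]

/-- `Λ ↦ P⁻¹Λ` reflects and preserves `≤` (it is injective). [cite: Kottwitz1986, §3] -/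
theorem map_inv_le_map_inv_iff (P : GL (Fin n) F) (Λ₁ Λ₂ : Submodule 𝒪[F] (Fin n → F)) :
    Λ₁.map ((Matrix.toLin' ((P⁻¹ : GL (Fin n) F) : Matrix (Fin n) (Fin n) F)).restrictScalars 𝒪[F]) ≤
        Λ₂.map ((Matrix.toLin' ((P⁻¹ : GL (Fin n) F) : Matrix (Fin n) (Fin n) F)).restrictScalars 𝒪[F]) ↔ Λ₁ ≤ Λ₂ := by
  refine Submodule.map_le_map_iff_of_injective (fun v w hvw => ?_) _ _
  have h := congrArg (fun x => ((P : GL (Fin n) F) : Matrix (Fin n) (Fin n) F) *ᵥ x) hvw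
  simpa only [LinearMap.coe_restrictScalars, Matrix.toLin'_apply, Matrix.mulVec_mulVec, Units.mul_inv, Matrix.one_mulVec] using h

/-- **`P⁻¹ · S_{A,b}(J, γ) = S_{P⁻¹AP, b}(ᵗσ(P) J P, P⁻¹ γ P)`**: the REFINED version of ★ `image_map_inv_selfDualStable_eq` — under `Λ ↦ P⁻¹Λ` the extra condition
`A·Λ ≤ b·Λ` becomes `(P⁻¹AP)·Λ′ ≤ b·Λ′` (`map_map_inv_conj_eq`, and `P⁻¹(b·1)P = b·1`). [cite: Kottwitz1986, §3] [cite: Kottwitz1988, §2] -/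
theorem image_map_inv_selfDualStable_mapLE_eq (J : Matrix (Fin n) (Fin n) F) (γ P : GL (Fin n) F) (A : Matrix (Fin n) (Fin n) F) (b : F) :
    (fun Λ : Submodule 𝒪[F] (Fin n → F) => Λ.map ((Matrix.toLin' ((P⁻¹ : GL (Fin n) F) : Matrix (Fin n) (Fin n) F)).restrictScalars 𝒪[F])) ''
        {Λ : Submodule 𝒪[F] (Fin n → F) |
          ((∃ g : GL (Fin n) F, (∃ J' ∈ glInt n F, (J' : Matrix (Fin n) (Fin n) F) = formCongr σ g J) ∧
              Λ = Submodule.span 𝒪[F] (Set.range ((g : Matrix (Fin n) (Fin n) F))ᵀ)) ∧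
            Λ.map ((Matrix.toLin' ((γ : GL (Fin n) F) : Matrix (Fin n) (Fin n) F)).restrictScalars 𝒪[F]) = Λ) ∧
          Λ.map ((Matrix.toLin' A).restrictScalars 𝒪[F]) ≤ Λ.map ((Matrix.toLin' (b • (1 : Matrix (Fin n) (Fin n) F))).restrictScalars 𝒪[F])} =
      {Λ : Submodule 𝒪[F] (Fin n → F) |
        ((∃ g : GL (Fin n) F, (∃ J' ∈ glInt n F, (J' : Matrix (Fin n) (Fin n) F) = formCongr σ g (formCongr σ P J)) ∧
            Λ = Submodule.span 𝒪[F] (Set.range ((g : Matrix (Fin n) (Fin n) F))ᵀ)) ∧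
          Λ.map ((Matrix.toLin' (((P⁻¹ * γ * P : GL (Fin n) F)) : Matrix (Fin n) (Fin n) F)).restrictScalars 𝒪[F]) = Λ) ∧
        Λ.map ((Matrix.toLin' (((P⁻¹ : GL (Fin n) F) : Matrix (Fin n) (Fin n) F) * A * (P : Matrix (Fin n) (Fin n) F))).restrictScalars 𝒪[F]) ≤
          Λ.map ((Matrix.toLin' (b • (1 : Matrix (Fin n) (Fin n) F))).restrictScalars 𝒪[F])} := by
  -- the plain image (★ (L5-d1)) and the behaviour of the extra predicate
  have hplain := image_map_inv_selfDualStable_eq σ J γ P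
  have hpred : ∀ Λ : Submodule 𝒪[F] (Fin n → F),
      (Λ.map ((Matrix.toLin' ((P⁻¹ : GL (Fin n) F) : Matrix (Fin n) (Fin n) F)).restrictScalars 𝒪[F])).map
            ((Matrix.toLin' (((P⁻¹ : GL (Fin n) F) : Matrix (Fin n) (Fin n) F) * A * (P : Matrix (Fin n) (Fin n) F))).restrictScalars 𝒪[F]) ≤
          (Λ.map ((Matrix.toLin' ((P⁻¹ : GL (Fin n) F) : Matrix (Fin n) (Fin n) F)).restrictScalars 𝒪[F])).map
            ((Matrix.toLin' (b • (1 : Matrix (Fin n) (Fin n) F))).restrictScalars 𝒪[F]) ↔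
        Λ.map ((Matrix.toLin' A).restrictScalars 𝒪[F]) ≤ Λ.map ((Matrix.toLin' (b • (1 : Matrix (Fin n) (Fin n) F))).restrictScalars 𝒪[F]) := by
    intro Λ
    have hb : (Λ.map ((Matrix.toLin' ((P⁻¹ : GL (Fin n) F) : Matrix (Fin n) (Fin n) F)).restrictScalars 𝒪[F])).map
          ((Matrix.toLin' (b • (1 : Matrix (Fin n) (Fin n) F))).restrictScalars 𝒪[F]) =
        (Λ.map ((Matrix.toLin' (b • (1 : Matrix (Fin n) (Fin n) F))).restrictScalars 𝒪[F])).map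
          ((Matrix.toLin' ((P⁻¹ : GL (Fin n) F) : Matrix (Fin n) (Fin n) F)).restrictScalars 𝒪[F]) := by
      rw [← units_inv_mul_smul_one_mul P b, map_map_inv_conj_eq, units_inv_mul_smul_one_mul]
    rw [map_map_inv_conj_eq, hb, map_inv_le_map_inv_iff]
  ext Λ'
  constructor
  · rintro ⟨Λ, ⟨hΛ, hle⟩, rfl⟩
    have hmem : Λ.map ((Matrix.toLin' ((P⁻¹ : GL (Fin n) F) : Matrix (Fin n) (Fin n) F)).restrictScalars 𝒪[F]) ∈
        (fun Λ : Submodule 𝒪[F] (Fin n → F) => Λ.map ((Matrix.toLin' ((P⁻¹ : GL (Fin n) F) : Matrix (Fin n) (Fin n) F)).restrictScalars 𝒪[F])) ''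
          {Λ : Submodule 𝒪[F] (Fin n → F) |
            (∃ g : GL (Fin n) F, (∃ J' ∈ glInt n F, (J' : Matrix (Fin n) (Fin n) F) = formCongr σ g J) ∧
                Λ = Submodule.span 𝒪[F] (Set.range ((g : Matrix (Fin n) (Fin n) F))ᵀ)) ∧
              Λ.map ((Matrix.toLin' ((γ : GL (Fin n) F) : Matrix (Fin n) (Fin n) F)).restrictScalars 𝒪[F]) = Λ} := ⟨Λ, hΛ, rfl⟩
    rw [hplain] at hmem
    exact ⟨hmem, (hpred Λ).2 hle⟩
  · rintro ⟨hΛ', hle'⟩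
    have hmem : Λ' ∈ (fun Λ : Submodule 𝒪[F] (Fin n → F) => Λ.map ((Matrix.toLin' ((P⁻¹ : GL (Fin n) F) : Matrix (Fin n) (Fin n) F)).restrictScalars 𝒪[F])) ''
          {Λ : Submodule 𝒪[F] (Fin n → F) |
            (∃ g : GL (Fin n) F, (∃ J' ∈ glInt n F, (J' : Matrix (Fin n) (Fin n) F) = formCongr σ g J) ∧
                Λ = Submodule.span 𝒪[F] (Set.range ((g : Matrix (Fin n) (Fin n) F))ᵀ)) ∧
              Λ.map ((Matrix.toLin' ((γ : GL (Fin n) F) : Matrix (Fin n) (Fin n) F)).restrictScalars 𝒪[F]) = Λ} := by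
      rw [hplain]; exact hΛ'
    obtain ⟨Λ, hΛ, rfl⟩ := hmem
    exact ⟨Λ, ⟨hΛ, (hpred Λ).1 hle'⟩, rfl⟩

/-- **REFINED FRAME TRANSPORT OF THE COUNT: `#S_{A,b}(J, γ) = #S_{P⁻¹AP, b}(ᵗσ(P) J P, P⁻¹ γ P)`** for every `P ∈ GL_n(F)` (`Λ ↦ P⁻¹Λ` is injective and maps one refined set onto
the other, `image_map_inv_selfDualStable_mapLE_eq`).  The number of `γ`-stable self-dual lattices ON WHICH `A ≡ 0 (mod b)` is a function of `(form, γ, A)` up to simultaneous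
change of basis. [cite: Kottwitz1986, §3] [cite: Kottwitz1988, §2] -/
theorem ncard_selfDualStable_mapLE_congr (J : Matrix (Fin n) (Fin n) F) (γ P : GL (Fin n) F) (A : Matrix (Fin n) (Fin n) F) (b : F) :
    {Λ : Submodule 𝒪[F] (Fin n → F) |
        ((∃ g : GL (Fin n) F, (∃ J' ∈ glInt n F, (J' : Matrix (Fin n) (Fin n) F) = formCongr σ g J) ∧
            Λ = Submodule.span 𝒪[F] (Set.range ((g : Matrix (Fin n) (Fin n) F))ᵀ)) ∧
          Λ.map ((Matrix.toLin' ((γ : GL (Fin n) F) : Matrix (Fin n) (Fin n) F)).restrictScalars 𝒪[F]) = Λ) ∧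
        Λ.map ((Matrix.toLin' A).restrictScalars 𝒪[F]) ≤ Λ.map ((Matrix.toLin' (b • (1 : Matrix (Fin n) (Fin n) F))).restrictScalars 𝒪[F])}.ncard =
      {Λ : Submodule 𝒪[F] (Fin n → F) |
        ((∃ g : GL (Fin n) F, (∃ J' ∈ glInt n F, (J' : Matrix (Fin n) (Fin n) F) = formCongr σ g (formCongr σ P J)) ∧
            Λ = Submodule.span 𝒪[F] (Set.range ((g : Matrix (Fin n) (Fin n) F))ᵀ)) ∧
          Λ.map ((Matrix.toLin' (((P⁻¹ * γ * P : GL (Fin n) F)) : Matrix (Fin n) (Fin n) F)).restrictScalars 𝒪[F]) = Λ) ∧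
        Λ.map ((Matrix.toLin' (((P⁻¹ : GL (Fin n) F) : Matrix (Fin n) (Fin n) F) * A * (P : Matrix (Fin n) (Fin n) F))).restrictScalars 𝒪[F]) ≤
          Λ.map ((Matrix.toLin' (b • (1 : Matrix (Fin n) (Fin n) F))).restrictScalars 𝒪[F])}.ncard := by
  rw [← image_map_inv_selfDualStable_mapLE_eq σ J γ P A b, Set.ncard_image_of_injective]
  intro Λ₁ Λ₂ h
  exact le_antisymm ((map_inv_le_map_inv_iff P Λ₁ Λ₂).1 h.le) ((map_inv_le_map_inv_iff P Λ₂ Λ₁).1 h.ge)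

/-- **The scalar-shift form**: `#{Λ ∈ S(J, γ) | (γ − a·1)·Λ ≤ b·Λ} = #{Λ ∈ S(ᵗσ(P)JP, P⁻¹γP) | (P⁻¹γP − a·1)·Λ ≤ b·Λ}` — the count of the `γ`-fixed vertices at which the local
monodromy reduces to the scalar `a` (for `b = ϖ`) is frame-independent. [cite: Kottwitz1986, §3] [cite: Kottwitz1988, §2] -/
theorem ncard_selfDualStable_subSmul_congr (J : Matrix (Fin n) (Fin n) F) (γ P : GL (Fin n) F) (a b : F) :
    {Λ : Submodule 𝒪[F] (Fin n → F) |
        ((∃ g : GL (Fin n) F, (∃ J' ∈ glInt n F, (J' : Matrix (Fin n) (Fin n) F) = formCongr σ g J) ∧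
            Λ = Submodule.span 𝒪[F] (Set.range ((g : Matrix (Fin n) (Fin n) F))ᵀ)) ∧
          Λ.map ((Matrix.toLin' ((γ : GL (Fin n) F) : Matrix (Fin n) (Fin n) F)).restrictScalars 𝒪[F]) = Λ) ∧
        Λ.map ((Matrix.toLin' (((γ : GL (Fin n) F) : Matrix (Fin n) (Fin n) F) - a • (1 : Matrix (Fin n) (Fin n) F))).restrictScalars 𝒪[F]) ≤
          Λ.map ((Matrix.toLin' (b • (1 : Matrix (Fin n) (Fin n) F))).restrictScalars 𝒪[F])}.ncard =
      {Λ : Submodule 𝒪[F] (Fin n → F) |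
        ((∃ g : GL (Fin n) F, (∃ J' ∈ glInt n F, (J' : Matrix (Fin n) (Fin n) F) = formCongr σ g (formCongr σ P J)) ∧
            Λ = Submodule.span 𝒪[F] (Set.range ((g : Matrix (Fin n) (Fin n) F))ᵀ)) ∧
          Λ.map ((Matrix.toLin' (((P⁻¹ * γ * P : GL (Fin n) F)) : Matrix (Fin n) (Fin n) F)).restrictScalars 𝒪[F]) = Λ) ∧
        Λ.map ((Matrix.toLin' ((((P⁻¹ * γ * P : GL (Fin n) F)) : Matrix (Fin n) (Fin n) F) - a • (1 : Matrix (Fin n) (Fin n) F))).restrictScalars 𝒪[F]) ≤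
          Λ.map ((Matrix.toLin' (b • (1 : Matrix (Fin n) (Fin n) F))).restrictScalars 𝒪[F])}.ncard := by
  rw [ncard_selfDualStable_mapLE_congr σ J γ P _ b, units_inv_mul_sub_smul_one_mul, Units.val_mul, Units.val_mul, Matrix.mul_assoc]

end Transport

/-! ## §2 The refined fixed-coset dictionary in `U(σ, J)`: `#{x ∈ Fix_γ(U ⧸ K_U) | b⁻¹ (out x)⁻¹ A (out x) integral} = #{Λ(u) | γΛ = Λ ∧ AΛ ≤ bΛ}` -/

section Unitary

/-- The dictionary inside `U = U(σ, J)` (plain-matrix form of ★ `map_span_range_transpose_eq_self_iff_smul_mk_eq_unitary`): for `u, γ ∈ U`,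
`γ · Λ(u) = Λ(u) ↔ u K_U ∈ Fix_γ(U ⧸ K_U)`. [cite: Kottwitz1986, §3] -/
theorem map_span_range_transpose_eq_self_iff_mem_fixedBy_unitary (J : Matrix (Fin n) (Fin n) F) (γ u : ↥(unitaryGroupOfForm σ J)) :
    (Submodule.span 𝒪[F] (Set.range (((u : GL (Fin n) F) : Matrix (Fin n) (Fin n) F))ᵀ)).map
        ((Matrix.toLin' (((γ : GL (Fin n) F) : Matrix (Fin n) (Fin n) F))).restrictScalars 𝒪[F]) =
      Submodule.span 𝒪[F] (Set.range (((u : GL (Fin n) F) : Matrix (Fin n) (Fin n) F))ᵀ) ↔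
      ((u : ↥(unitaryGroupOfForm σ J)) : ↥(unitaryGroupOfForm σ J) ⧸ (glInt n F).subgroupOf (unitaryGroupOfForm σ J)) ∈
        MulAction.fixedBy (↥(unitaryGroupOfForm σ J) ⧸ (glInt n F).subgroupOf (unitaryGroupOfForm σ J)) γ := by
  rw [map_span_range_transpose_eq_self_iff, mem_fixedBy_quotient_mk_iff, Subgroup.mem_subgroupOf, Subgroup.coe_mul,
    Subgroup.coe_mul, Subgroup.coe_inv]


/-- **`Nat.card {x ∈ Fix_γ(U ⧸ K_U) | b⁻¹·((out x)⁻¹ A (out x))` integral`} = #{Λ(u), u ∈ U | γ Λ(u) = Λ(u) ∧ A·Λ(u) ≤ b·Λ(u)}`** for `U = U(σ, J) ≤ GL_n(F)`,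
`K_U = U ∩ GL_n(𝒪)`, any matrix `A` and scalar `b ≠ 0`: the refinement of ★ `natCard_fixedBy_unitary_eq_ncard` by the predicate `A·Λ ≤ b·Λ`, read on the representative
`out x` through ★ `map_le_map_smul_one_iff`.  With `A = γ − a·1`, `b = ϖ` the left side counts the fixed vertices whose local monodromy `(out x)⁻¹ γ (out x) ∈ K_U`
is `≡ a·1 (mod ϖ)`. [cite: Kottwitz1988, §2] [cite: Kottwitz1986, §3] -/
theorem natCard_fixedBy_unitary_subtype_eq_ncard (J : Matrix (Fin n) (Fin n) F) (γ : ↥(unitaryGroupOfForm σ J)) (A : Matrix (Fin n) (Fin n) F) {b : F} (hb : b ≠ 0) :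
    Nat.card {x : MulAction.fixedBy (↥(unitaryGroupOfForm σ J) ⧸ (glInt n F).subgroupOf (unitaryGroupOfForm σ J)) γ //
        ∀ i j, (b⁻¹ • (((((x.1.out : ↥(unitaryGroupOfForm σ J)) : GL (Fin n) F)⁻¹ : GL (Fin n) F) : Matrix (Fin n) (Fin n) F) * A *
          (((x.1.out : ↥(unitaryGroupOfForm σ J)) : GL (Fin n) F) : Matrix (Fin n) (Fin n) F))) i j ∈ 𝒪[F]} =
      {Λ : Submodule 𝒪[F] (Fin n → F) |
        ((∃ u ∈ unitaryGroupOfForm σ J, Λ = Submodule.span 𝒪[F] (Set.range ((u : Matrix (Fin n) (Fin n) F))ᵀ)) ∧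
            Λ.map ((Matrix.toLin' (((γ : GL (Fin n) F) : Matrix (Fin n) (Fin n) F))).restrictScalars 𝒪[F]) = Λ) ∧
          Λ.map ((Matrix.toLin' A).restrictScalars 𝒪[F]) ≤ Λ.map ((Matrix.toLin' (b • (1 : Matrix (Fin n) (Fin n) F))).restrictScalars 𝒪[F])}.ncard := by
  classical
  -- the map `x ↦ Λ(out x)`
  set Φ : {x : MulAction.fixedBy (↥(unitaryGroupOfForm σ J) ⧸ (glInt n F).subgroupOf (unitaryGroupOfForm σ J)) γ //
        ∀ i j, (b⁻¹ • (((((x.1.out : ↥(unitaryGroupOfForm σ J)) : GL (Fin n) F)⁻¹ : GL (Fin n) F) : Matrix (Fin n) (Fin n) F) * A *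
          (((x.1.out : ↥(unitaryGroupOfForm σ J)) : GL (Fin n) F) : Matrix (Fin n) (Fin n) F))) i j ∈ 𝒪[F]} → Submodule 𝒪[F] (Fin n → F) :=
    fun x => Submodule.span 𝒪[F] (Set.range ((((x.1.1.out : ↥(unitaryGroupOfForm σ J)) : GL (Fin n) F) : Matrix (Fin n) (Fin n) F))ᵀ) with hΦ
  -- `Λ(out (u K_U)) = Λ(u)`
  have hout : ∀ u : ↥(unitaryGroupOfForm σ J),
      Submodule.span 𝒪[F] (Set.range (((((u : ↥(unitaryGroupOfForm σ J) ⧸ (glInt n F).subgroupOf (unitaryGroupOfForm σ J)).out :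
          ↥(unitaryGroupOfForm σ J)) : GL (Fin n) F) : Matrix (Fin n) (Fin n) F))ᵀ) =
        Submodule.span 𝒪[F] (Set.range ((((u : GL (Fin n) F)) : Matrix (Fin n) (Fin n) F))ᵀ) := by
    intro u
    obtain ⟨k, hk⟩ := QuotientGroup.mk_out_eq_mul ((glInt n F).subgroupOf (unitaryGroupOfForm σ J)) u
    rw [hk, Subgroup.coe_mul, eq_comm, span_range_transpose_eq_iff, inv_mul_cancel_left]
    exact (Subgroup.mem_subgroupOf).1 k.2
  -- the predicate on a representative is the lattice predicate (★ `map_le_map_smul_one_iff`)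
  have hpred : ∀ u : ↥(unitaryGroupOfForm σ J),
      (∀ i j, (b⁻¹ • ((((u : GL (Fin n) F)⁻¹ : GL (Fin n) F) : Matrix (Fin n) (Fin n) F) * A * (((u : GL (Fin n) F)) : Matrix (Fin n) (Fin n) F))) i j ∈ 𝒪[F]) ↔
        (Submodule.span 𝒪[F] (Set.range ((((u : GL (Fin n) F)) : Matrix (Fin n) (Fin n) F))ᵀ)).map ((Matrix.toLin' A).restrictScalars 𝒪[F]) ≤
          (Submodule.span 𝒪[F] (Set.range ((((u : GL (Fin n) F)) : Matrix (Fin n) (Fin n) F))ᵀ)).map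
            ((Matrix.toLin' (b • (1 : Matrix (Fin n) (Fin n) F))).restrictScalars 𝒪[F]) := fun u => (map_le_map_smul_one_iff (u : GL (Fin n) F) A hb).symm
  have hinj : Function.Injective Φ := by
    intro x x' h
    have h' := (span_range_transpose_eq_iff
      ((x.1.1.out : ↥(unitaryGroupOfForm σ J)) : GL (Fin n) F) ((x'.1.1.out : ↥(unitaryGroupOfForm σ J)) : GL (Fin n) F)).1 h
    apply Subtype.ext; apply Subtype.ext
    rw [← Quotient.out_eq x.1.1, ← Quotient.out_eq x'.1.1]
    refine QuotientGroup.eq.2 ((Subgroup.mem_subgroupOf).2 ?_)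
    rw [Subgroup.coe_mul, Subgroup.coe_inv]
    exact h'
  have himage : Set.range Φ =
      {Λ : Submodule 𝒪[F] (Fin n → F) |
        ((∃ u ∈ unitaryGroupOfForm σ J, Λ = Submodule.span 𝒪[F] (Set.range ((u : Matrix (Fin n) (Fin n) F))ᵀ)) ∧
            Λ.map ((Matrix.toLin' (((γ : GL (Fin n) F) : Matrix (Fin n) (Fin n) F))).restrictScalars 𝒪[F]) = Λ) ∧
          Λ.map ((Matrix.toLin' A).restrictScalars 𝒪[F]) ≤ Λ.map ((Matrix.toLin' (b • (1 : Matrix (Fin n) (Fin n) F))).restrictScalars 𝒪[F])} := by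
    ext Λ
    simp only [Set.mem_range, Set.mem_setOf_eq]
    constructor
    · rintro ⟨x, rfl⟩
      have hq : x.1.1 = ((x.1.1.out : ↥(unitaryGroupOfForm σ J)) : ↥(unitaryGroupOfForm σ J) ⧸ (glInt n F).subgroupOf (unitaryGroupOfForm σ J)) :=
        (Quotient.out_eq x.1.1).symm
      refine ⟨⟨⟨((x.1.1.out : ↥(unitaryGroupOfForm σ J)) : GL (Fin n) F), (x.1.1.out).2, rfl⟩, ?_⟩, (hpred x.1.1.out).1 x.2⟩
      have hfix := x.1.2
      rw [hq] at hfix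
      exact (map_span_range_transpose_eq_self_iff_mem_fixedBy_unitary σ J γ x.1.1.out).2 hfix
    · rintro ⟨⟨⟨u, hu, rfl⟩, hΛ⟩, hle⟩
      have hfix : (((⟨u, hu⟩ : ↥(unitaryGroupOfForm σ J)) : ↥(unitaryGroupOfForm σ J) ⧸ (glInt n F).subgroupOf (unitaryGroupOfForm σ J))) ∈
          MulAction.fixedBy (↥(unitaryGroupOfForm σ J) ⧸ (glInt n F).subgroupOf (unitaryGroupOfForm σ J)) γ :=
        (map_span_range_transpose_eq_self_iff_mem_fixedBy_unitary σ J γ ⟨u, hu⟩).1 hΛ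
      refine ⟨⟨⟨_, hfix⟩, fun i j => ?_⟩, hout ⟨u, hu⟩⟩
      have hle' := hle
      rw [← hout ⟨u, hu⟩, ← hpred] at hle'
      exact hle' i j
  rw [← Set.ncard_univ, ← Set.ncard_image_of_injective Set.univ hinj, Set.image_univ, himage]

end Unitary

/-! ## §3 The `2 × 2` monodromy dictionary -/

section TwoByTwo

variable {K : Type*} [Field K]

/-- **`(k − (tr k ∕ 2)·1)² = ((tr² − 4 det) ∕ 4)·1`** for a `2 × 2` matrix over a field with `2 ≠ 0` (Cayley–Hamilton `k² − tr·k + det = 0`). For a type-(2) elliptic element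
(`ϖ ∣ tr² − 4det`) every conjugate is therefore a scalar-or-transvection modulo `𝓂`. [cite: HornJohnson2013, Thm. 2.4.3.2] [cite: Kottwitz1988, §2] -/
theorem sub_smul_one_mul_self_eq_smul_one (h2 : (2 : K) ≠ 0) (k : Matrix (Fin 2) (Fin 2) K) :
    (k - (k.trace * 2⁻¹) • (1 : Matrix (Fin 2) (Fin 2) K)) * (k - (k.trace * 2⁻¹) • (1 : Matrix (Fin 2) (Fin 2) K)) =
      ((k.trace ^ 2 - 4 * k.det) * 4⁻¹) • (1 : Matrix (Fin 2) (Fin 2) K) := by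
  have h4 : (4 : K) ≠ 0 := by
    have : (4 : K) = 2 * 2 := by norm_num
    rw [this]; exact mul_ne_zero h2 h2
  rw [Matrix.trace_fin_two, Matrix.det_fin_two]
  ext i j
  fin_cases i <;> fin_cases j <;>
    · simp [Matrix.mul_apply, Fin.sum_univ_two, Matrix.one_apply]
      field_simp
      ring

/-- Trace of a conjugate: `tr(g⁻¹ k g) = tr k`. [cite: HornJohnson2013, §1.3] -/
theorem trace_units_inv_mul_mul {m : ℕ} (g : GL (Fin m) K) (k : Matrix (Fin m) (Fin m) K) :
    (((g⁻¹ : GL (Fin m) K) : Matrix (Fin m) (Fin m) K) * k * (g : Matrix (Fin m) (Fin m) K)).trace = k.trace := by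
  exact Matrix.trace_units_conj' g k

/-- Determinant of a conjugate: `det(g⁻¹ k g) = det k`. [cite: HornJohnson2013, §1.3] -/
theorem det_units_inv_mul_mul {m : ℕ} (g : GL (Fin m) K) (k : Matrix (Fin m) (Fin m) K) :
    (((g⁻¹ : GL (Fin m) K) : Matrix (Fin m) (Fin m) K) * k * (g : Matrix (Fin m) (Fin m) K)).det = k.det := by
  exact Matrix.det_units_conj' g k

end TwoByTwo

/-! ## §4 Reduction modulo `𝓂` -/

section Reduction

/-- **`k̄ = ā·1 ↔ ϖ⁻¹(k − a·1)` is integral** for `k ∈ GL_n(𝒪)`, `a ∈ 𝒪`, `ϖ` a uniformizer (entrywise: `|k_{ij} − a δ_{ij}| < 1 ↔ ϖ⁻¹(k_{ij} − aδ_{ij}) ∈ 𝒪`).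
[cite: IwahoriMatsumoto1965, §2] -/
theorem glIntReduction_eq_smul_one_iff {ϖ : F} (hϖ : IsUniformizingElement ϖ) (k : glInt n F) (a : 𝒪[F]) :
    ((glIntReduction n F k : GL (Fin n) 𝓀[F]) : Matrix (Fin n) (Fin n) 𝓀[F]) = IsLocalRing.residue 𝒪[F] a • (1 : Matrix (Fin n) (Fin n) 𝓀[F]) ↔
      ∀ i j, (ϖ⁻¹ • (((k : GL (Fin n) F) : Matrix (Fin n) (Fin n) F) - (a : F) • (1 : Matrix (Fin n) (Fin n) F))) i j ∈ 𝒪[F] := by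
  rw [← Matrix.ext_iff]
  refine forall_congr' fun i => forall_congr' fun j => ?_
  -- the `(i, j)` entry of `k − a·1` as an element of `𝒪`
  set δ : 𝒪[F] := if i = j then 1 else 0 with hδ
  have hδF : ((δ : 𝒪[F]) : F) = (1 : Matrix (Fin n) (Fin n) F) i j := by
    rw [hδ, Matrix.one_apply]; split_ifs <;> rfl
  have hδk : (IsLocalRing.residue 𝒪[F] δ : 𝓀[F]) = (1 : Matrix (Fin n) (Fin n) 𝓀[F]) i j := by
    rw [hδ, Matrix.one_apply]; split_ifs <;> simp
  set z : 𝒪[F] := ⟨((k : GL (Fin n) F) : Matrix (Fin n) (Fin n) F) i j, apply_mem_integer_of_mem_glInt k.2 i j⟩ - a * δ with hz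
  have hzF : ((z : 𝒪[F]) : F) = (((k : GL (Fin n) F) : Matrix (Fin n) (Fin n) F) - (a : F) • (1 : Matrix (Fin n) (Fin n) F)) i j := by
    rw [hz, Matrix.sub_apply, Matrix.smul_apply, ← hδF, smul_eq_mul]; push_cast; rfl
  have lhs : ((glIntReduction n F k : GL (Fin n) 𝓀[F]) : Matrix (Fin n) (Fin n) 𝓀[F]) i j =
      (IsLocalRing.residue 𝒪[F] a • (1 : Matrix (Fin n) (Fin n) 𝓀[F])) i j ↔ IsLocalRing.residue 𝒪[F] z = 0 := by
    rw [coe_glIntReduction_apply, Matrix.smul_apply, ← hδk, smul_eq_mul, ← map_mul, ← sub_eq_zero, ← map_sub]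
  rw [lhs, Matrix.smul_apply, ← hzF, smul_eq_mul]
  constructor
  · intro h0
    exact hϖ.inv_mul_mem z.2 (valuation_lt_one_of_residue_eq_zero h0)
  · intro hmem
    refine residue_eq_zero_of_valuation_lt_one ?_
    -- `z = ϖ · (ϖ⁻¹ z)` has valuation `< 1`
    have hx : ((z : 𝒪[F]) : F) = ϖ * (ϖ⁻¹ * (z : F)) := by rw [← mul_assoc, mul_inv_cancel₀ hϖ.ne_zero, one_mul]
    rw [hx, map_mul]
    calc valuation F ϖ * valuation F (ϖ⁻¹ * (z : F)) ≤ valuation F ϖ * 1 := mul_le_mul' le_rfl ((Valuation.mem_integer_iff _ _).1 hmem)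
      _ = valuation F ϖ := mul_one _
      _ < 1 := hϖ.valuation_lt_one

/-- The integral matrix underlying `k ∈ GL_n(𝒪)` reduces to `k̄` under `residue` (as a ring homomorphism on matrices). [cite: IwahoriMatsumoto1965, §2] -/
theorem glIntReduction_val_eq_map (k : glInt n F) :
    ((glIntReduction n F k : GL (Fin n) 𝓀[F]) : Matrix (Fin n) (Fin n) 𝓀[F]) =
      (IsLocalRing.residue 𝒪[F]).mapMatrix ((((glIntEquiv n F).symm k : GL (Fin n) 𝒪[F]) : Matrix (Fin n) (Fin n) 𝒪[F])) := by
  ext i j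
  rw [coe_glIntReduction_apply, RingHom.mapMatrix_apply, Matrix.map_apply, glIntEquiv_symm_apply_apply]

/-- The integral matrix underlying `k ∈ GL_n(𝒪)` maps to `k` under the inclusion `𝒪 ⊆ F`. [cite: IwahoriMatsumoto1965, §2] -/
theorem subtype_mapMatrix_glIntEquiv_symm (k : glInt n F) :
    (𝒪[F]).subtype.mapMatrix ((((glIntEquiv n F).symm k : GL (Fin n) 𝒪[F]) : Matrix (Fin n) (Fin n) 𝒪[F])) = ((k : GL (Fin n) F) : Matrix (Fin n) (Fin n) F) := by
  ext i j
  rw [RingHom.mapMatrix_apply, Matrix.map_apply, glIntEquiv_symm_apply_apply]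
  rfl

/-- **A square-nilpotent reduction**: if `(k − a·1)² = e·1` with `k ∈ GL_n(𝒪)`, `a, e ∈ 𝒪`, `|e| < 1`, then `(k̄ − ā·1)² = 0` in `M_n(𝓀)`. [cite: IwahoriMatsumoto1965, §2]
[cite: Kottwitz1988, §2] -/
theorem glIntReduction_sub_smul_one_sq_eq_zero (k : glInt n F) (a e : 𝒪[F]) (he : valuation F (e : F) < 1)
    (hk : (((k : GL (Fin n) F) : Matrix (Fin n) (Fin n) F) - (a : F) • (1 : Matrix (Fin n) (Fin n) F)) *
        (((k : GL (Fin n) F) : Matrix (Fin n) (Fin n) F) - (a : F) • (1 : Matrix (Fin n) (Fin n) F)) = (e : F) • (1 : Matrix (Fin n) (Fin n) F)) :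
    (((glIntReduction n F k : GL (Fin n) 𝓀[F]) : Matrix (Fin n) (Fin n) 𝓀[F]) - IsLocalRing.residue 𝒪[F] a • (1 : Matrix (Fin n) (Fin n) 𝓀[F])) *
        (((glIntReduction n F k : GL (Fin n) 𝓀[F]) : Matrix (Fin n) (Fin n) 𝓀[F]) - IsLocalRing.residue 𝒪[F] a • (1 : Matrix (Fin n) (Fin n) 𝓀[F])) = 0 := by
  -- lift the identity to `M_n(𝒪)` along the injective `subtype.mapMatrix`
  set kO : Matrix (Fin n) (Fin n) 𝒪[F] := (((glIntEquiv n F).symm k : GL (Fin n) 𝒪[F]) : Matrix (Fin n) (Fin n) 𝒪[F]) with hkO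
  have hinj : Function.Injective ((𝒪[F]).subtype.mapMatrix : Matrix (Fin n) (Fin n) 𝒪[F] →+* Matrix (Fin n) (Fin n) F) := fun M N h =>
    Matrix.ext fun i j => Subtype.ext (by simpa [RingHom.mapMatrix_apply] using congrFun (congrFun h i) j)
  have hO : (kO - a • (1 : Matrix (Fin n) (Fin n) 𝒪[F])) * (kO - a • (1 : Matrix (Fin n) (Fin n) 𝒪[F])) = e • (1 : Matrix (Fin n) (Fin n) 𝒪[F]) := by
    apply hinj
    have h1 : (𝒪[F]).subtype.mapMatrix (kO - a • (1 : Matrix (Fin n) (Fin n) 𝒪[F])) = ((k : GL (Fin n) F) : Matrix (Fin n) (Fin n) F) - (a : F) • (1 : Matrix (Fin n) (Fin n) F) := by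
      rw [map_sub, subtype_mapMatrix_glIntEquiv_symm]
      congr 1
      ext i j
      by_cases hij : i = j <;> simp [RingHom.mapMatrix_apply, Matrix.map_apply, Matrix.smul_apply, hij]
    have h2 : (𝒪[F]).subtype.mapMatrix (e • (1 : Matrix (Fin n) (Fin n) 𝒪[F])) = (e : F) • (1 : Matrix (Fin n) (Fin n) F) := by
      ext i j
      by_cases hij : i = j <;> simp [RingHom.mapMatrix_apply, Matrix.map_apply, Matrix.smul_apply, hij]
    rw [map_mul, h1, h2, hk]
  -- reduce
  have hred := congrArg ((IsLocalRing.residue 𝒪[F]).mapMatrix) hO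
  rw [map_mul, map_sub] at hred
  have h3 : (IsLocalRing.residue 𝒪[F]).mapMatrix (a • (1 : Matrix (Fin n) (Fin n) 𝒪[F])) = IsLocalRing.residue 𝒪[F] a • (1 : Matrix (Fin n) (Fin n) 𝓀[F]) := by
    ext i j
    by_cases hij : i = j
    · subst hij; simp [RingHom.mapMatrix_apply, Matrix.map_apply]
    · simp [RingHom.mapMatrix_apply, Matrix.map_apply, Matrix.one_apply_ne hij]
  have h4 : (IsLocalRing.residue 𝒪[F]).mapMatrix (e • (1 : Matrix (Fin n) (Fin n) 𝒪[F])) = 0 := by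
    have he0 : IsLocalRing.residue 𝒪[F] e = 0 := residue_eq_zero_of_valuation_lt_one he
    ext i j
    by_cases hij : i = j
    · subst hij
      rw [RingHom.mapMatrix_apply, Matrix.map_apply, Matrix.smul_apply, Matrix.one_apply_eq, smul_eq_mul, mul_one, he0, Matrix.zero_apply]
    · rw [RingHom.mapMatrix_apply, Matrix.map_apply, Matrix.smul_apply, Matrix.one_apply_ne hij, smul_zero, map_zero, Matrix.zero_apply]
  rw [h3, h4, ← glIntReduction_val_eq_map] at hred
  exact hred

/-- **A unit congruence reduces to an identity**: `x, y ∈ 𝒪` with `|x y − 1| < 1` have `x̄ ȳ = 1` (used with `x = σ(c)`, `y = c`: the residual NORM ONE of the double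
eigenvalue of a type-(2) monodromy). [cite: IwahoriMatsumoto1965, §2] -/
theorem residue_mul_residue_eq_one (x y : 𝒪[F]) (h : valuation F ((x : F) * y - 1) < 1) :
    IsLocalRing.residue 𝒪[F] x * IsLocalRing.residue 𝒪[F] y = 1 := by
  rw [← map_mul, ← map_one (IsLocalRing.residue 𝒪[F]), ← sub_eq_zero, ← map_sub]
  refine residue_eq_zero_of_valuation_lt_one ?_
  push_cast
  exact h

end Reduction

end Literature.NumberTheory.Automorphic

end
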